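import Summits.RiemannHypothesis.RiemannHypothesis.Theorems.GroundBartaEvenWinsBeyondArchDeflationTransfer
import HarnessLib

/-!
# RiemannHypothesis / GroundBarta — rung 4 (`EvenWinsBeyondArch`, stmt-RiemannHypothesis-18807 / 18085):
# the deflated Temple L-side with a WEIGHTED complement level — transfer to the form domain

Helper file (`--supports stmt-RiemannHypothesis-18085`), RH-free, no definitions, no named facts.  Prover A (gen 4 of
unit `sr-gb-rung-a`).

Weighted analogue of `dt_beta_transfer` (file II): a certificate with a POINTWISE level,
`∫ n|φ|² + λ ∫|φ|² ≤ Re Q(φ) + Σ_i μ_i |∫ φ v̄_i|²` on the smooth sector tests of the window (`n ≥ 0` bounded measurable —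
for the refined three-prime sliver `n + λ = β₂₃ − (log 2)/2 · 𝟙_{|y| ≥ log 4 − c}`), passes to every `h` of the sector
form domain orthogonal to the `v_i`: `∫ n|h|² + λ ∫|h|² ≤ P(h) + 𝓔_c(h) − M_c ∫|h|²`.  Same density argument
(`dt_exists_sector_test_near`); the one new estimate is `∫ n|h|² ≤ (1 + t) ∫ n|φ|² + (1 + 1/t) C ∫|φ − h|²` (Young).
-/

set_option linter.dupNamespace false

noncomputable section

open MeasureTheory Set Filter
open scoped Topology ENNReal NNReal ComplexConjugate

namespace Summit.RiemannHypothesis.RiemannHypothesis.Theorems.EvenWinsBeyondArch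

open Literature.NumberTheory.LFunctions Literature.NumberTheory.LFunctions.ConnesVanSuijlekom

/-- `∫ n‖f‖²` is finite for `f ∈ L²` and bounded measurable `n`. [folklore] -/
theorem dt_integrable_weight_mul_norm_sq {n : ℝ → ℝ} (hnm : Measurable n) {C : ℝ} (hnC : ∀ y, |n y| ≤ C)
    {f : ℝ → ℂ} (hf : MemLp f 2) : Integrable fun y ↦ n y * ‖f y‖ ^ 2 :=
  ((memLp_two_iff_integrable_sq_norm hf.1).1 hf).bdd_mul hnm.aestronglyMeasurable
    (Eventually.of_forall fun y ↦ by rw [Real.norm_eq_abs]; exact hnC y)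

/-- Young: `n‖h‖² ≤ (1 + t) n‖φ‖² + (1 + 1/t) n‖φ − h‖²` pointwise for `n ≥ 0`, `t > 0`. [folklore] -/
theorem dt_weight_norm_sq_le_young {n : ℝ} (hn : 0 ≤ n) {t : ℝ} (ht : 0 < t) (a b : ℂ) :
    n * ‖b‖ ^ 2 ≤ (1 + t) * (n * ‖a‖ ^ 2) + (1 + 1 / t) * (n * ‖a - b‖ ^ 2) := by
  have h1 : ‖b‖ ≤ ‖a‖ + ‖a - b‖ := by
    calc ‖b‖ = ‖a - (a - b)‖ := by rw [sub_sub_cancel]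
      _ ≤ ‖a‖ + ‖a - b‖ := norm_sub_le _ _
  have h2 : ‖b‖ ^ 2 ≤ (‖a‖ + ‖a - b‖) ^ 2 := pow_le_pow_left₀ (norm_nonneg _) h1 2
  have h3 : (‖a‖ + ‖a - b‖) ^ 2 ≤ (1 + t) * ‖a‖ ^ 2 + (1 + 1 / t) * ‖a - b‖ ^ 2 := by
    have key : 2 * ‖a‖ * ‖a - b‖ ≤ t * ‖a‖ ^ 2 + (1 / t) * ‖a - b‖ ^ 2 := by
      have h0 : 0 ≤ (t * ‖a‖ - ‖a - b‖) ^ 2 / t := by positivity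
      have e : (t * ‖a‖ - ‖a - b‖) ^ 2 / t = t * ‖a‖ ^ 2 + (1 / t) * ‖a - b‖ ^ 2 - 2 * ‖a‖ * ‖a - b‖ := by
        field_simp
        ring
      linarith [h0, e]
    nlinarith [key]
  have h4 := mul_le_mul_of_nonneg_left (h2.trans h3) hn
  linarith [h4]

/-- **Transfer of a weighted sector certificate to the form domain.**  Let `c > 0`, `σ ∈ ℂ`, `v₁ … v_k ∈ L²`,
`μ_i ≥ 0`, `λ ∈ ℝ`, `n ≥ 0` measurable with `|n| ≤ C`, and suppose
`∫ n|φ|² + λ∫|φ|² ≤ Re Q(φ) + Σ_i μ_i |∫ φ v̄_i|²` for every smooth test `φ` supported in `[-c, c]` with `φ(-x) = σ φ(x)`.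
Then every `h ∈ L²` vanishing off `[-c, c]`, of parity `σ`, with finite archimedean energy and `∫ h v̄_i = 0` for all `i`,
satisfies `∫ n|h|² + λ∫|h|² ≤ P(h) + 𝓔_c(h) − M_c ∫|h|²`. [folklore] -/
theorem dt_beta_transfer_w {c : ℝ} (hc : 0 < c) (σ : ℂ) {k : ℕ} (v : Fin k → ℝ → ℂ)
    (hv : ∀ i, MemLp (v i) 2) (μ : Fin k → ℝ) (hμ : ∀ i, 0 ≤ μ i) (lam : ℝ)
    {n : ℝ → ℝ} (hnm : Measurable n) {C : ℝ} (hnC : ∀ y, |n y| ≤ C) (hn0 : ∀ y, 0 ≤ n y)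
    (hcert : ∀ φ : ℝ → ℂ, IsWeilTest φ → tsupport φ ⊆ Icc (-c) c → (∀ x, φ (-x) = σ * φ x) →
      (∫ y, n y * ‖φ y‖ ^ 2) + lam * ∫ x, ‖φ x‖ ^ 2 ≤
        (weilQuadratic φ).re + ∑ i, μ i * ‖∫ x, φ x * conj (v i x)‖ ^ 2)
    {h : ℝ → ℂ} (hh : MemLp h 2) (hhs : ∀ x, x ∉ Icc (-c) c → h x = 0) (hpar : ∀ x, h (-x) = σ * h x)
    (hE : IntegrableOn (fun t ↦ weilArchDensity t * weilIncrement h t) (Ioi 0))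
    (horth : ∀ i, ∫ x, h x * conj (v i x) = 0) :
    (∫ y, n y * ‖h y‖ ^ 2) + lam * ∫ x, ‖h x‖ ^ 2 ≤
      weilPoleForm h + weilDirichletEnergy c h - weilMarkovConstant c * ∫ x, ‖h x‖ ^ 2 := by
  set M : ℝ := weilMarkovConstant c with hM
  set Nv : Fin k → ℝ := fun i ↦ ∫ x, ‖v i x‖ ^ 2 with hNv
  have hNv0 : ∀ i, 0 ≤ Nv i := fun i ↦ integral_nonneg fun _ ↦ by positivity
  set Nh : ℝ := ∫ x, ‖h x‖ ^ 2 with hNh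
  have hNh0 : 0 ≤ Nh := integral_nonneg fun _ ↦ by positivity
  have hC0 : 0 ≤ C := (abs_nonneg _).trans (hnC 0)
  have hμN : 0 ≤ ∑ i, μ i * Nv i := Finset.sum_nonneg fun i _ ↦ mul_nonneg (hμ i) (hNv0 i)
  refine le_of_forall_pos_lt_add fun ε hε ↦ ?_
  -- the Young parameter `t` with `t C Nh ≤ ε/4`
  set t : ℝ := ε / (4 * (C * Nh + 1)) with ht
  have ht0 : 0 < t := by positivity
  have htC : t * (C * Nh) ≤ ε / 4 := by
    have e : t * (C * Nh + 1) = ε / 4 := by rw [ht]; field_simp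
    nlinarith [e, ht0]
  -- the closeness parameter `δ` with `δ K < ε/2`
  set K : ℝ := |lam| + 2 + |M| + ∑ i, μ i * Nv i + (1 + 1 / t) * C + t * C with hK
  have hK0 : 0 ≤ K := by rw [hK]; positivity
  set δ : ℝ := ε / (2 * (K + 1)) with hδ
  have hδ0 : 0 < δ := by positivity
  have hδK : δ * K < ε / 2 := by
    have e : δ * (K + 1) = ε / 2 := by rw [hδ]; field_simp
    nlinarith [e, hδ0]
  obtain ⟨φ, hφt, hφs, hφpar, hL, hP, hN, hD⟩ := dt_exists_sector_test_near hc σ hh hhs hpar hE hδ0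
  have hφm : MemLp φ 2 := hφt.memLp_two
  have hc1 := hcert φ hφt hφs hφpar
  rw [weilQuadratic_re_eq_weilPoleForm_add_weilDirichletEnergy_sub hφt hφs, ← hM] at hc1
  -- the pairings are small: `|∫ φ v̄_i|² ≤ δ ∫|v_i|²`
  have hpair : ∀ i, ‖∫ x, φ x * conj (v i x)‖ ^ 2 ≤ δ * Nv i := by
    intro i
    have h1 := dt_norm_pairing_sub_le hφm hh (hv i)
    rw [horth i, sub_zero] at h1
    have h2 : ‖∫ x, φ x * conj (v i x)‖ ^ 2 ≤
        (Real.sqrt (Nv i) * Real.sqrt (∫ x, ‖φ x - h x‖ ^ 2)) ^ 2 :=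
      pow_le_pow_left₀ (norm_nonneg _) h1 2
    rw [mul_pow, Real.sq_sqrt (hNv0 i), Real.sq_sqrt (integral_nonneg fun _ ↦ by positivity)] at h2
    calc ‖∫ x, φ x * conj (v i x)‖ ^ 2 ≤ Nv i * ∫ x, ‖φ x - h x‖ ^ 2 := h2
      _ ≤ Nv i * δ := mul_le_mul_of_nonneg_left hL.le (hNv0 i)
      _ = δ * Nv i := mul_comm _ _
  have hsum : ∑ i, μ i * ‖∫ x, φ x * conj (v i x)‖ ^ 2 ≤ δ * ∑ i, μ i * Nv i := by
    rw [Finset.mul_sum]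
    refine Finset.sum_le_sum fun i _ ↦ ?_
    calc μ i * ‖∫ x, φ x * conj (v i x)‖ ^ 2 ≤ μ i * (δ * Nv i) :=
          mul_le_mul_of_nonneg_left (hpair i) (hμ i)
      _ = δ * (μ i * Nv i) := by ring
  -- the weighted norms: `∫ n|h|² ≤ (1+t) ∫ n|φ|² + (1+1/t) C δ`, `∫ n|φ|² ≤ C ∫|φ|²`
  have hInh := dt_integrable_weight_mul_norm_sq hnm hnC hh
  have hInφ := dt_integrable_weight_mul_norm_sq hnm hnC hφm
  have hIdiff : Integrable fun y ↦ ‖φ y - h y‖ ^ 2 :=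
    (memLp_two_iff_integrable_sq_norm (hφm.sub hh).1).1 (hφm.sub hh)
  have hInd := dt_integrable_weight_mul_norm_sq hnm hnC (hφm.sub hh)
  have hY : (∫ y, n y * ‖h y‖ ^ 2) ≤ (1 + t) * (∫ y, n y * ‖φ y‖ ^ 2) + (1 + 1 / t) * (C * δ) := by
    have h1 : (∫ y, n y * ‖h y‖ ^ 2) ≤ ∫ y, ((1 + t) * (n y * ‖φ y‖ ^ 2) + (1 + 1 / t) * (n y * ‖(φ - h) y‖ ^ 2)) :=
      integral_mono hInh ((hInφ.const_mul _).add (hInd.const_mul _))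
        fun y ↦ by simpa only [Pi.sub_apply] using dt_weight_norm_sq_le_young (hn0 y) ht0 (φ y) (h y)
    rw [integral_add (hInφ.const_mul _) (hInd.const_mul _), integral_const_mul, integral_const_mul] at h1
    have h2 : (∫ y, n y * ‖(φ - h) y‖ ^ 2) ≤ C * δ := by
      calc (∫ y, n y * ‖(φ - h) y‖ ^ 2) ≤ ∫ y, C * ‖φ y - h y‖ ^ 2 :=
            integral_mono hInd (hIdiff.const_mul C) fun y ↦ by
              simp only [Pi.sub_apply]
              exact mul_le_mul_of_nonneg_right ((le_abs_self _).trans (hnC y)) (by positivity)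
        _ = C * ∫ y, ‖φ y - h y‖ ^ 2 := integral_const_mul _ _
        _ ≤ C * δ := mul_le_mul_of_nonneg_left hL.le hC0
    have h3 : (1 + 1 / t) * (∫ y, n y * ‖(φ - h) y‖ ^ 2) ≤ (1 + 1 / t) * (C * δ) :=
      mul_le_mul_of_nonneg_left h2 (by positivity)
    linarith
  have hnφ : (∫ y, n y * ‖φ y‖ ^ 2) ≤ C * ∫ x, ‖φ x‖ ^ 2 := by
    calc (∫ y, n y * ‖φ y‖ ^ 2) ≤ ∫ y, C * ‖φ y‖ ^ 2 :=
          integral_mono hInφ (((memLp_two_iff_integrable_sq_norm hφm.1).1 hφm).const_mul C) fun y ↦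
            mul_le_mul_of_nonneg_right ((le_abs_self _).trans (hnC y)) (by positivity)
      _ = C * ∫ x, ‖φ x‖ ^ 2 := integral_const_mul _ _
  have hnφ0 : 0 ≤ ∫ y, n y * ‖φ y‖ ^ 2 := integral_nonneg fun y ↦ mul_nonneg (hn0 y) (by positivity)
  -- bookkeeping
  have hP' := abs_sub_lt_iff.1 hP
  have hN' := abs_sub_lt_iff.1 hN
  have hφN : (∫ x, ‖φ x‖ ^ 2) ≤ Nh + δ := by linarith [hN'.1]
  have hl1 : lam * Nh ≤ lam * (∫ x, ‖φ x‖ ^ 2) + |lam| * δ := by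
    have h0 : |lam * (Nh - ∫ x, ‖φ x‖ ^ 2)| ≤ |lam| * δ := by
      rw [abs_mul]
      exact mul_le_mul_of_nonneg_left (by rw [abs_sub_comm]; exact hN.le) (abs_nonneg _)
    have h1 := (abs_le.1 h0).2
    rw [mul_sub] at h1
    linarith
  have hM1 : -(M * ∫ x, ‖φ x‖ ^ 2) ≤ -(M * Nh) + |M| * δ := by
    have h0 : |M * ((∫ x, ‖φ x‖ ^ 2) - Nh)| ≤ |M| * δ := by
      rw [abs_mul]
      exact mul_le_mul_of_nonneg_left hN.le (abs_nonneg _)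
    have h1 := (abs_le.1 h0).1
    rw [mul_sub] at h1
    linarith
  -- `t ∫ n|φ|² ≤ t C (Nh + δ)`
  have htφ : t * (∫ y, n y * ‖φ y‖ ^ 2) ≤ t * (C * Nh) + t * C * δ := by
    have := mul_le_mul_of_nonneg_left (hnφ.trans (mul_le_mul_of_nonneg_left hφN hC0)) ht0.le
    linarith
  have hKe : δ * K = |lam| * δ + δ + δ + |M| * δ + δ * ∑ i, μ i * Nv i + (1 + 1 / t) * (C * δ) + t * C * δ := by
    rw [hK]; ring
  have htot : (∫ y, n y * ‖h y‖ ^ 2) + lam * Nh ≤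
      weilPoleForm h + weilDirichletEnergy c h - M * Nh + δ * K + ε / 4 := by
    rw [hKe]
    nlinarith [hc1, hsum, hl1, hM1, hP'.1, hD, hY, htφ, htC, hnφ0, ht0.le]
  calc (∫ y, n y * ‖h y‖ ^ 2) + lam * Nh
      ≤ weilPoleForm h + weilDirichletEnergy c h - M * Nh + δ * K + ε / 4 := htot
    _ < weilPoleForm h + weilDirichletEnergy c h - M * Nh + ε := by linarith

end Summit.RiemannHypothesis.RiemannHypothesis.Theorems.EvenWinsBeyondArch

end
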